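import Summits.BirchSwinnertonDyer.BirchSwinnertonDyer.Theorems.SylvesterTwoHeegnerIndexUpperOffV0DualityTwoCore
import HarnessLib

/-!
# The `2`-torsion layer at a Kolyvagin prime: ISOTROPY of the eigen-span and LEVEL-ONE RIGIDITY

Helper file of route `SylvesterTwoHeegnerIndex` (cell bsd-cm, rung K7t), crux `UpperOffV0HSYPlus` (item
19804; «find: 19229» hand k7t-c2 g7), line `offv0-kolyvagin2`.  THEOREMS ONLY, pure algebra; no
elliptic curve, no definition, no named fact.

## Setting (= `…UpperOffV0EisensteinTorsion` / `…EisensteinConj` / `…DualityTwoCore`)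
`N` finite of order `4^M` with `θ : N →+ N`, `θ² + θ + 1 = 0` (`N = E[2^M]`, `θ = [ω]`, for a CM
curve `y² = x³ − c` over `ℚ`), `P ∈ N` of order `2^M` (a real `2^M`-torsion point), and a
`θ`-semilinear additive `τ` fixing `P` (complex conjugation; equivalently the arithmetic Frobenius of
a Kolyvagin prime `ℓ` — `Frob(ℓ) = Frob(∞)` on `K(E[2^M])`).  An alternating biadditive
`e : N →+ N →+ A` is the local Tate pairing at the inert prime `λ = (ℓ)` of `K`,
`H¹_ur(K_λ, E[2^M]) × H¹(K_λ, E)[2^M] → ℤ/2^M`, both factors identified with `N` (Kolyvagin (7.6);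
`…DualityTwoCore`, module docstring).

## What is proved (k7t-c2 g7)
* `pairing_lin_lin` — `e(αP + βθP, cP + dθP) = (αd − βc)·e(P, θP)` (the pairing is a determinant);
* `two_smul_eq_zero_and_tau_eq_self_iff` — the `2`-torsion `τ`-fixed vectors are exactly
  `2^{M-1}ℤ·P` (the line `{0, 2^{M-1}P}`);
* `mem_eigenClosure_iff` — the `ℤ`-span of ALL `τ`-eigenvectors (`τ y = ±y`) is `ℤP + 2ℤθP`, of
  index `2` in `N` (cf. `theta_not_mem_eigen_sum`);
* **`pairing_eq_zero_of_two_torsion_fixed_of_mem_eigenClosure` (ISOTROPY)** — `e x y = 0 = e y x`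
  for every `2`-torsion `τ`-fixed `x` and every `y` in the eigen-span, for EVERY alternating `e`;
* **`pairing_halfGen_eq_zero_iff_mem_eigenClosure` (EXACTNESS)** — for `e` alternating and
  left-non-degenerate, the annihilator of `2^{M-1}P` is EXACTLY the eigen-span;
* **`tau_eq_self_of_two_torsion_of_pairing_eigen_eq_zero` (LOCAL RIGIDITY)** — a `2`-torsion `x`
  orthogonal to ONE `τ`-eigenvector `y` of full order (`2^{M-1} y ≠ 0`) is `τ`-fixed;
* `SylvesterTwoUpper.LevelOne.tau_eq_self_of_locTrivial_of_cebotarev` (GLOBAL RIGIDITY, in the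
  abstract currency of McCallum's descent, `…UpperOffV0DescentDefect*`) — if the anti-symmetrisation
  `s − τ s` of every Selmer class is locally trivial at every Kolyvagin prime where the distinguished
  `τ`-fixed class `x` is not, and Čebotarev (McCallum Cor. 3.2) holds for the `τ`-eigen pairs
  `{x, d}`, then EVERY Selmer class is `τ`-fixed.

## Dictionary and meaning for the crux (docstrings carry the details)
In Kolyvagin's argument over the Heegner field `K` at `p = 2` (Gross 1991 §§8–10 with `p = 2`):
(i) every derivative class `d_M(n)` is a `τ`-EIGENclass (Gross Prop. 5.4), so its singular part at a
Kolyvagin prime lies on an eigenline of `N`, and every `ℤ`-combination of such classes has singular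
part in the eigen-span; (ii) a `2`-TORSION Selmer class `s ∈ Sel₂(E/K) = Sel_{2^M}(E/K)[2]`
(`E(K)[2] = 0`) localises into `N[2] = 2^{M-1}N`, and onto the fixed line `{0, 2^{M-1}P}` iff `s_λ`
is `τ`-fixed.  ISOTROPY says: Kolyvagin's reciprocity relation `⟨s_λ, d_λ⟩ = 0` (Gross Prop. 8.2 /
the registered stub (e)) is EMPTY for `τ`-fixed `2`-torsion Selmer classes against every Heegner-point
class at every level `M` — at an odd `p` the two eigenlines `𝔽_p·P`, `𝔽_p·√−3P` are distinct and
pair perfectly (Gross Prop. 8.1), at `2` they COINCIDE modulo `2` (`√−3 = 1 + 2ω ≡ 1`).  LOCAL +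
GLOBAL RIGIDITY say what the relations DO give on the `2`-torsion layer: `Sel₂(E/K)` is pointwise
`τ`-fixed, i.e. `Sel₂(E/K) = (res H¹(ℚ, E[2])) ∩ Sel` (Gross's Claim 10.1 "`Sel^{-ε} = 0`" becomes
"`Sel = Sel^{τ}`" at `2`), and EXACTNESS says nothing more can follow.  Consequence (memo
K7T-UPPER-ISOTROPY-k7t-c2-g7): the NUMBER OF CYCLIC FACTORS of `Ш(E_p/K)[2^∞]` (`dim Ш[2]/2Ш[4]`)
is invisible to stubs (d)+(e); the ORDER form of stub (f)+(g) needs an independent `2`-rank input,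
while the EXPONENT form (landed with defect `4`: `…UpperOffV0DescentDefect`) is what the method
addresses.  HONEST FRAMING: typed obstruction + structure lemma; closes no item; B14 = O12 open as a
class; BSD not claimed.  References: [GrossLMS1991] §5 Prop. 5.4, §8 Props. 8.1–8.2, §9 Props.
9.3–9.6, §10 Claims 10.1/10.3; [McCallumLMS1991] §3 Cor. 3.2, §5 Lemma 5.3.
-/

set_option autoImplicit false
set_option linter.dupNamespace false

namespace Summit.BirchSwinnertonDyer.BirchSwinnertonDyer.Theorems.SylvesterTwoUpper.EisensteinTorsion

open Literature.NumberTheory.EllipticCurves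

variable {N : Type*} [AddCommGroup N] (θ : N →+ N) (hθ : ∀ x, θ (θ x) + θ x + x = 0)
  (τ : N →+ N) (hτθ : ∀ x, τ (θ x) = θ (θ (τ x))) {P : N} (hτP : τ P = P)
  [Finite N] {M : ℕ} (hcard : Nat.card N = 4 ^ M) (hP : addOrderOf P = 2 ^ M)

/-! ## §0 The pairing in coordinates -/

omit [Finite N] in
/-- Alternating biadditive pairings are skew: `e y x = −e x y`. [folklore] -/
theorem pairing_skew_of_alt {A : Type*} [AddCommGroup A] (e : N →+ N →+ A)
    (halt : ∀ x, e x x = 0) (x y : N) : e y x = -e x y := by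
  have h := halt (x + y)
  rw [e.map_add, AddMonoidHom.add_apply, (e x).map_add, (e y).map_add, halt, halt, zero_add,
    add_zero] at h
  exact (neg_eq_of_add_eq_zero_right h).symm

omit [Finite N] in
/-- **The pairing is a determinant**: `e(αP + βθP, cP + dθP) = (αd − βc)·e(P, θP)` for an
alternating biadditive `e`. [folklore] -/
theorem pairing_lin_lin {A : Type*} [AddCommGroup A] (e : N →+ N →+ A) (halt : ∀ x, e x x = 0)
    (α β c d : ℤ) :
    e (α • P + β • θ P) (c • P + d • θ P) = (α * d - β * c) • e P (θ P) := by
  rw [e.map_add, AddMonoidHom.add_apply, (e (α • P)).map_add, (e (β • θ P)).map_add,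
    KolyvaginEigenPow.pairing_zsmul_left, KolyvaginEigenPow.pairing_zsmul_left,
    KolyvaginEigenPow.pairing_zsmul_left, KolyvaginEigenPow.pairing_zsmul_left, (e P).map_zsmul,
    (e P).map_zsmul, (e (θ P)).map_zsmul, (e (θ P)).map_zsmul, halt, halt,
    pairing_skew_of_alt e halt P (θ P)]
  module

include hθ hcard hP in
/-- `2^M` kills `e(P, θP)` with room for a factor: `(2^M k)·e(P, θP) = 0`. [folklore] -/
theorem pow_mul_zsmul_pairing_eq_zero {A : Type*} [AddCommGroup A] (e : N →+ N →+ A) (k : ℤ) :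
    ((2 : ℤ) ^ M * k) • e P (θ P) = 0 := by
  rw [← KolyvaginEigenPow.pairing_zsmul_left, pow_mul_zsmul_eq_zero θ hθ hcard hP k P, map_zero,
    AddMonoidHom.zero_apply]

include hθ hcard hP in
/-- For `e` alternating and left-non-degenerate, `m·e(P, θP) = 0` iff `2^M ∣ m`
(`addOrderOf_pairing_theta_eq`). [folklore] -/
theorem zsmul_pairing_eq_zero_iff (hM : 1 ≤ M) {A : Type*} [AddCommGroup A] (e : N →+ N →+ A)
    (halt : ∀ x, e x x = 0) (hnd : ∀ x, (∀ y, e x y = 0) → x = 0) (m : ℤ) :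
    m • e P (θ P) = 0 ↔ (2 : ℤ) ^ M ∣ m := by
  have hω := (addOrderOf_pairing_theta_eq θ hθ hcard hP hM e halt hnd).1
  rw [← addOrderOf_dvd_iff_zsmul_eq_zero, hω]
  push_cast
  exact Iff.rfl

/-! ## §1 The two sub-lattices: `2`-torsion fixed vectors and the eigen-span -/

include hθ hτθ hτP hcard hP in
/-- **The `2`-torsion `τ`-fixed vectors are `2^{M-1}ℤ·P`** (`M ≥ 1`): `2x = 0 ∧ τ x = x` iff
`x = 2^{M-1}α·P`.  (Dictionary: the localisation at a Kolyvagin prime of a `τ`-fixed class of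
`Sel₂(E/K) ↪ Sel_{2^M}(E/K)[2]`.) [folklore] -/
theorem two_smul_eq_zero_and_tau_eq_self_iff (hM : 1 ≤ M) (x : N) :
    ((2 : ℤ) • x = 0 ∧ τ x = x) ↔ ∃ α : ℤ, x = (2 ^ (M - 1) * α) • P := by
  have e2 : (2 : ℤ) ^ M = 2 * 2 ^ (M - 1) := by
    rw [← pow_succ', Nat.sub_add_cancel hM]
  constructor
  · rintro ⟨h2, hτx⟩
    obtain ⟨a, rfl⟩ := (tau_eq_self_iff θ hθ τ hτθ hτP hcard hP _).mp hτx
    have h0 : (2 * a) • P + (0 : ℤ) • θ P = 0 := by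
      rw [zero_zsmul, add_zero, mul_zsmul, h2]
    obtain ⟨ha, -⟩ := dvd_and_dvd_of_lin_eq_zero θ hθ M P hP _ _ h0
    rw [e2] at ha
    obtain ⟨α, hα⟩ := Int.dvd_of_mul_dvd_mul_left two_ne_zero ha
    exact ⟨α, by rw [hα]⟩
  · rintro ⟨α, rfl⟩
    refine ⟨?_, by rw [map_zsmul, hτP]⟩
    rw [smul_smul, ← mul_assoc, ← e2]
    exact pow_mul_zsmul_eq_zero θ hθ hcard hP α P

include hθ hτθ hτP hcard hP in
/-- **The `ℤ`-span of the `τ`-eigenvectors is `ℤP + 2ℤθP`**: `y` lies in the additive subgroup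
generated by `{y | τ y = y ∨ τ y = −y}` iff `y = a·P + 2b·θP` (`N⁺ = ℤP`, `N⁻ = ℤ(P + 2θP)` by
`tau_eq_self_iff` / `tau_eq_neg_iff`).  (Dictionary: singular parts at `λ` of arbitrary
`ℤ`-combinations of Kolyvagin classes `d_M(n)`, each a `τ`-eigenclass by Gross Prop. 5.4.)
[cite: GrossLMS1991, §5 Prop. 5.4] -/
theorem mem_eigenClosure_iff (y : N) :
    y ∈ AddSubgroup.closure {y : N | τ y = y ∨ τ y = -y} ↔
      ∃ a b : ℤ, y = a • P + (2 * b) • θ P := by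
  constructor
  · intro hy
    induction hy using AddSubgroup.closure_induction with
    | mem z hz =>
      rcases hz with hz | hz
      · obtain ⟨a, rfl⟩ := (tau_eq_self_iff θ hθ τ hτθ hτP hcard hP z).mp hz
        exact ⟨a, 0, by rw [mul_zero, zero_zsmul, add_zero]⟩
      · obtain ⟨a, rfl⟩ := (tau_eq_neg_iff θ hθ τ hτθ hτP hcard hP z).mp hz
        exact ⟨a, a, by rw [zsmul_add, smul_smul, mul_comm]⟩
    | zero => exact ⟨0, 0, by simp⟩
    | add z w _ _ hz hw =>
      obtain ⟨a, b, rfl⟩ := hz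
      obtain ⟨a', b', rfl⟩ := hw
      exact ⟨a + a', b + b', by rw [mul_add, add_zsmul, add_zsmul]; abel⟩
    | neg z _ hz =>
      obtain ⟨a, b, rfl⟩ := hz
      exact ⟨-a, -b, by rw [mul_neg, neg_zsmul, neg_zsmul, neg_add]⟩
  · rintro ⟨a, b, rfl⟩
    have hPmem : P ∈ AddSubgroup.closure {y : N | τ y = y ∨ τ y = -y} :=
      AddSubgroup.subset_closure (Or.inl hτP)
    have hQmem : P + (2 : ℤ) • θ P ∈ AddSubgroup.closure {y : N | τ y = y ∨ τ y = -y} :=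
      AddSubgroup.subset_closure
        (Or.inr ((tau_eq_neg_iff θ hθ τ hτθ hτP hcard hP _).mpr ⟨1, by rw [one_zsmul]⟩))
    have e : a • P + (2 * b) • θ P = (a - b) • P + b • (P + (2 : ℤ) • θ P) := by
      rw [zsmul_add, smul_smul, mul_comm b 2, sub_zsmul]
      abel
    rw [e]
    exact add_mem (AddSubgroup.zsmul_mem _ hPmem _) (AddSubgroup.zsmul_mem _ hQmem _)

/-! ## §2 ISOTROPY: the eigen-span is orthogonal to the `2`-torsion fixed line, for EVERY
alternating pairing -/

include hθ hτθ hτP hcard hP in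
/-- **ISOTROPY.**  In `N = E[2^M]` (`M ≥ 1`) with complex conjugation `τ`, let `e` be ANY
alternating biadditive pairing.  If `x` is `2`-torsion and `τ`-fixed and `y` lies in the `ℤ`-span of
the `τ`-eigenvectors, then `e x y = 0` and `e y x = 0`.
Proof: `x = 2^{M-1}α·P`, `y = a·P + 2b·θP`, so `e x y = 2^M αb·e(P, θP) = 0` (`pairing_lin_lin`).
DICTIONARY / MEANING.  `x` = the localisation `s_λ ∈ H¹_ur(K_λ, E[2^M]) ≅ N` of a `τ`-fixed
`2`-torsion Selmer class (`Sel₂(E/K) ↪ Sel_{2^M}(E/K)[2]`, `E(K)[2] = 0`); `y` = the singular part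
`d_λ ∈ H¹(K_λ, E)[2^M] ≅ N` of any `ℤ`-combination of Kolyvagin derivative classes `d_M(n)` (each a
`τ`-eigenclass: Gross Prop. 5.4 (2); the sign `ε_n` and the twist by `μ_{2^M}` only exchange the two
eigenlines); `e` = the local Tate pairing.  So Kolyvagin's reciprocity law `⟨s_λ, d_λ⟩_λ = 0` (Gross
Prop. 8.2; the registered stub (e) `stub_kolyvaginReciprocity_two`) is satisfied IDENTICALLY on
`τ`-fixed `2`-torsion Selmer classes, at EVERY level `M` and for EVERY auxiliary Heegner class: the
`2`-torsion layer `Ш(E/K)[2]/2Ш(E/K)[4]` — the number of cyclic factors of `Ш(E/K)[2^∞]` — is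
invisible to the method.  At an odd prime the same determinant reads `e(αP, b√−3P) = 2αb·e(P,θP)`,
a PERFECT pairing of the two eigenlines (Gross Prop. 8.1 (2)); at `2` the eigenlines coincide modulo
`2` (`√−3 = 1 + 2θ`).  This is the typed reason why the ORDER form of the crux's stub (f)+(g) cannot
follow from stubs (d)+(e) alone (an EXPONENT bound does: `…UpperOffV0DescentDefect`).
[cite: GrossLMS1991, §5 Prop. 5.4 (2), §8 Props. 8.1–8.2] -/
theorem pairing_eq_zero_of_two_torsion_fixed_of_mem_eigenClosure (hM : 1 ≤ M) {A : Type*}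
    [AddCommGroup A] (e : N →+ N →+ A) (halt : ∀ x, e x x = 0) {x y : N}
    (h2x : (2 : ℤ) • x = 0) (hτx : τ x = x)
    (hy : y ∈ AddSubgroup.closure {y : N | τ y = y ∨ τ y = -y}) :
    e x y = 0 ∧ e y x = 0 := by
  obtain ⟨α, rfl⟩ :=
    (two_smul_eq_zero_and_tau_eq_self_iff θ hθ τ hτθ hτP hcard hP hM x).mp ⟨h2x, hτx⟩
  obtain ⟨a, b, rfl⟩ := (mem_eigenClosure_iff θ hθ τ hτθ hτP hcard hP y).mp hy
  have key : e ((2 ^ (M - 1) * α) • P) (a • P + (2 * b) • θ P) = 0 := by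
    have h := pairing_lin_lin θ (P := P) e halt (2 ^ (M - 1) * α) 0 a (2 * b)
    rw [zero_zsmul, add_zero] at h
    rw [h, show (2 : ℤ) ^ (M - 1) * α * (2 * b) - 0 * a = 2 ^ M * (α * b) by
      rw [show (2 : ℤ) ^ M = 2 * 2 ^ (M - 1) by rw [← pow_succ', Nat.sub_add_cancel hM]]; ring]
    exact pow_mul_zsmul_pairing_eq_zero θ hθ hcard hP e (α * b)
  exact ⟨key, by rw [pairing_skew_of_alt e halt, key, neg_zero]⟩

include hθ hτθ hτP hcard hP in
/-- **ISOTROPY for a single eigenclass** (the form in which it is used: `y = d_M(n)_λ` with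
`τ y = ν y`, `ν = ±1`): `e x y = 0 = e y x` for every `2`-torsion `τ`-fixed `x`.
[cite: GrossLMS1991, §8 Prop. 8.2] -/
theorem pairing_eq_zero_of_two_torsion_fixed_of_eigen (hM : 1 ≤ M) {A : Type*} [AddCommGroup A]
    (e : N →+ N →+ A) (halt : ∀ x, e x x = 0) {x y : N} (h2x : (2 : ℤ) • x = 0) (hτx : τ x = x)
    {ν : ℤ} (hν : ν = 1 ∨ ν = -1) (hy : τ y = ν • y) : e x y = 0 ∧ e y x = 0 := by
  refine pairing_eq_zero_of_two_torsion_fixed_of_mem_eigenClosure θ hθ τ hτθ hτP hcard hP hM e halt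
    h2x hτx (AddSubgroup.subset_closure ?_)
  rcases hν with rfl | rfl
  · exact Or.inl (by rwa [one_zsmul] at hy)
  · exact Or.inr (by rwa [neg_one_zsmul] at hy)

/-! ## §3 EXACTNESS: the annihilator of the fixed `2`-torsion line is exactly the eigen-span -/

include hθ hτθ hτP hcard hP in
/-- **EXACTNESS.**  For `e` alternating and left-non-degenerate (so `e(P, θP)` has order `2^M`,
`addOrderOf_pairing_theta_eq`), `e(2^{M-1}P, y) = 0` iff `y` lies in the eigen-span `ℤP + 2ℤθP`.
MEANING: an auxiliary class CAN constrain the `τ`-fixed `2`-torsion layer iff its singular part at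
`λ` has an odd `θP`-coordinate, i.e. lies OUTSIDE the span of all `τ`-eigenvectors — e.g. an
`[ω]`-multiple of a Kolyvagin class, which is defined over `K(ω)` but not over `K` (and over `K(ω)`
the two primes above `λ` re-symmetrise the relation: global duality is `ℤ[ω]`-balanced).  No
Heegner-point class over `K` qualifies. [cite: GrossLMS1991, §8 Prop. 8.1] -/
theorem pairing_halfGen_eq_zero_iff_mem_eigenClosure (hM : 1 ≤ M) {A : Type*} [AddCommGroup A]
    (e : N →+ N →+ A) (halt : ∀ x, e x x = 0) (hnd : ∀ x, (∀ y, e x y = 0) → x = 0) (y : N) :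
    e (((2 : ℤ) ^ (M - 1)) • P) y = 0 ↔ y ∈ AddSubgroup.closure {y : N | τ y = y ∨ τ y = -y} := by
  constructor
  · intro h0
    obtain ⟨a, b, rfl⟩ := exists_lin_eq θ hθ hcard hP y
    have h := pairing_lin_lin θ (P := P) e halt (2 ^ (M - 1)) 0 a b
    rw [zero_zsmul, add_zero, zero_mul, sub_zero] at h
    rw [h, zsmul_pairing_eq_zero_iff θ hθ hcard hP hM e halt hnd] at h0
    -- `2^M ∣ 2^{M-1} b`, so `b` is even
    have hb : (2 : ℤ) ∣ b := by
      rw [show (2 : ℤ) ^ M = 2 ^ (M - 1) * 2 by rw [← pow_succ, Nat.sub_add_cancel hM]] at h0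
      exact Int.dvd_of_mul_dvd_mul_left (pow_ne_zero _ two_ne_zero) h0
    obtain ⟨b', rfl⟩ := hb
    exact (mem_eigenClosure_iff θ hθ τ hτθ hτP hcard hP _).mpr ⟨a, b', rfl⟩
  · intro hy
    refine (pairing_eq_zero_of_two_torsion_fixed_of_mem_eigenClosure θ hθ τ hτθ hτP hcard hP hM e
      halt ?_ (by rw [map_zsmul, hτP]) hy).1
    rw [smul_smul, show (2 : ℤ) * 2 ^ (M - 1) = 2 ^ M * 1 by
      rw [mul_one, ← pow_succ', Nat.sub_add_cancel hM]]
    exact pow_mul_zsmul_eq_zero θ hθ hcard hP 1 P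

/-! ## §4 LOCAL RIGIDITY: what ONE full-order eigenclass does give on the `2`-torsion layer -/

include hθ hτθ hτP hcard hP in
/-- A `τ`-eigenvector `y` (`τ y = ±y`) with `2^{M-1} y ≠ 0` is `cP + 2c'θP` with `c` ODD
(`c' = 0` resp. `c' = c`). [folklore] -/
theorem exists_odd_lin_of_eigen_of_full (hM : 1 ≤ M) {y : N} {ν : ℤ} (hν : ν = 1 ∨ ν = -1)
    (hy : τ y = ν • y) (hfull : ((2 : ℤ) ^ (M - 1)) • y ≠ 0) :
    ∃ c c' : ℤ, ¬ (2 : ℤ) ∣ c ∧ y = c • P + (2 * c') • θ P := by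
  have e2 : (2 : ℤ) ^ M = 2 ^ (M - 1) * 2 := by rw [← pow_succ, Nat.sub_add_cancel hM]
  have hkill : ∀ (c₁ : ℤ) (Q : N), (2 ^ (M - 1) * (2 * c₁)) • Q = 0 := fun c₁ Q ↦ by
    rw [← mul_assoc, ← e2]
    exact pow_mul_zsmul_eq_zero θ hθ hcard hP c₁ Q
  rcases hν with rfl | rfl
  · rw [one_zsmul] at hy
    obtain ⟨c, rfl⟩ := (tau_eq_self_iff θ hθ τ hτθ hτP hcard hP y).mp hy
    refine ⟨c, 0, fun ⟨c₁, hc₁⟩ ↦ hfull ?_, by rw [mul_zero, zero_zsmul, add_zero]⟩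
    rw [hc₁, smul_smul]
    exact hkill c₁ P
  · rw [neg_one_zsmul] at hy
    obtain ⟨c, rfl⟩ := (tau_eq_neg_iff θ hθ τ hτθ hτP hcard hP y).mp hy
    refine ⟨c, c, fun ⟨c₁, hc₁⟩ ↦ hfull ?_, by rw [zsmul_add, smul_smul, mul_comm c 2]⟩
    rw [hc₁, smul_smul, zsmul_add, smul_smul, mul_assoc, hkill c₁ P, zero_add,
      show (2 : ℤ) ^ (M - 1) * (2 * c₁ * 2) = 2 ^ (M - 1) * (2 * (c₁ * 2)) by ring]
    exact hkill (c₁ * 2) (θ P)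

include hθ hτθ hτP hcard hP in
/-- **LOCAL RIGIDITY.**  If `x` is `2`-torsion, `y` is a `τ`-eigenvector (`τ y = ±y`) of full
order (`2^{M-1} y ≠ 0`) and `e x y = 0` for an alternating left-non-degenerate `e`, then `τ x = x`.
Proof: `x = 2^{M-1}(a₀P + b₀θP)`, `y = cP + 2c'θP` with `c` odd, and by `pairing_lin_lin`
`e x y = (2^M a₀c' − 2^{M-1}b₀c)·e(P, θP) = −2^{M-1}b₀c·e(P, θP)`; the order of `e(P, θP)` is
`2^M`, so `b₀` is even and `x = 2^{M-1}a₀P`.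
DICTIONARY: `y = d_M(ℓ)_λ` at a Kolyvagin prime `ℓ` of TYPE I (`2^{M-1} d_λ ≠ 0`: the Heegner point
`y_K` is not more `2`-divisible in `E(K_λ)` than globally — Gross Prop. 6.2 / McCallum Prop. 4.4),
`x = s_λ` for ANY `s ∈ Sel₂(E/K)`; conclusion: `s_λ` is `τ`-fixed, i.e. `(s − τs)_λ = 0`.  This is
the `p = 2` content of Gross's Claim 10.1 (`Sel^{−ε} = 0` at odd `p`), the input `hloc` of
`LevelOne.tau_eq_self_of_locTrivial_of_cebotarev` below.
[cite: GrossLMS1991, §8 Prop. 8.2, §10 Claim 10.1] [cite: McCallumLMS1991, §5 Lemma 5.3] -/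
theorem tau_eq_self_of_two_torsion_of_pairing_eigen_eq_zero (hM : 1 ≤ M) {A : Type*}
    [AddCommGroup A] (e : N →+ N →+ A) (halt : ∀ x, e x x = 0)
    (hnd : ∀ x, (∀ y, e x y = 0) → x = 0) {x y : N} (h2x : (2 : ℤ) • x = 0)
    {ν : ℤ} (hν : ν = 1 ∨ ν = -1) (hy : τ y = ν • y) (hfull : ((2 : ℤ) ^ (M - 1)) • y ≠ 0)
    (hexy : e x y = 0) : τ x = x := by
  have e2 : (2 : ℤ) ^ M = 2 * 2 ^ (M - 1) := by rw [← pow_succ', Nat.sub_add_cancel hM]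
  -- `x = 2^{M-1}(a₀ P + b₀ θP)`: from `2x = 0`, both coordinates of `x` are divisible by `2^{M-1}`
  obtain ⟨a, b, rfl⟩ := exists_lin_eq θ hθ hcard hP x
  have h0 : (2 * a) • P + (2 * b) • θ P = 0 := by
    rw [mul_zsmul, mul_zsmul, ← zsmul_add, h2x]
  obtain ⟨ha, hb⟩ := dvd_and_dvd_of_lin_eq_zero θ hθ M P hP _ _ h0
  rw [e2] at ha hb
  obtain ⟨a₀, rfl⟩ := Int.dvd_of_mul_dvd_mul_left two_ne_zero ha
  obtain ⟨b₀, rfl⟩ := Int.dvd_of_mul_dvd_mul_left two_ne_zero hb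
  -- `y = cP + 2c'θP` with `c` odd
  obtain ⟨c, c', hc, rfl⟩ := exists_odd_lin_of_eigen_of_full θ hθ τ hτθ hτP hcard hP hM hν hy hfull
  -- the pairing value
  rw [pairing_lin_lin θ e halt, show (2 : ℤ) ^ (M - 1) * a₀ * (2 * c') - 2 ^ (M - 1) * b₀ * c =
      2 ^ M * (a₀ * c') + -(2 ^ (M - 1) * (b₀ * c)) by rw [e2]; ring, add_zsmul,
    pow_mul_zsmul_pairing_eq_zero θ hθ hcard hP e, zero_add, neg_zsmul, neg_eq_zero,
    zsmul_pairing_eq_zero_iff θ hθ hcard hP hM e halt hnd] at hexy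
  -- `2^M ∣ 2^{M-1} b₀ c`, `c` odd ⇒ `b₀` even
  rw [e2, mul_comm (2 : ℤ)] at hexy
  have h2 : (2 : ℤ) ∣ b₀ * c := Int.dvd_of_mul_dvd_mul_left (pow_ne_zero _ two_ne_zero) hexy
  have hb₀ : (2 : ℤ) ∣ b₀ := by
    rcases Int.prime_two.dvd_or_dvd h2 with h | h
    · exact h
    · exact absurd h hc
  obtain ⟨b₁, rfl⟩ := hb₀
  have hz : (2 ^ (M - 1) * (2 * b₁)) • θ P = 0 := by
    rw [show (2 : ℤ) ^ (M - 1) * (2 * b₁) = 2 ^ M * b₁ by rw [e2]; ring]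
    exact pow_mul_zsmul_eq_zero θ hθ hcard hP b₁ (θ P)
  rw [hz, add_zero, map_zsmul, hτP]

end Summit.BirchSwinnertonDyer.BirchSwinnertonDyer.Theorems.SylvesterTwoUpper.EisensteinTorsion

/-! ## §5 GLOBAL RIGIDITY in the abstract currency of McCallum's descent

Setting of `…UpperOffV0DescentDefect*` (`KolyvaginDescent`): an additive group `V`
(`= H¹(K, E[2])`) with an additive involution `τ`, a Selmer subgroup `Sel ≤ V`, Kolyvagin primes
`Kol ℓ`, the subgroups `A ℓ ≤ V` of classes that are LOCALLY TRIVIAL at the prime `λ ∣ ℓ`, and a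
distinguished `τ`-fixed Selmer class `x` (`= δy_K`, `y_K ∉ 2E(K)`).  Two hypotheses:
`hloc` — at every Kolyvagin prime where `x` is not locally trivial (TYPE I), `s − τ s` IS locally
trivial for every `s ∈ Sel` (= LOCAL RIGIDITY above + Gross Props. 6.2/8.2, the content of the
registered stubs (d)+(e) at level `1`);  `hceb` — McCallum's Cor. 3.2 at `2`, `M = 1`, for the
`τ`-eigen pair `{x, d}` (`d` anti-fixed, `d ∉ {0, x}`): a Kolyvagin prime where neither is locally
trivial (the tree's `McCallum1991_cor_3_2_eigen` shape; at `2` for the Sylvester curves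
`…UpperOffV0CebotarevTwo(Shear)`).  Conclusion: `τ s = s` for every `s ∈ Sel`. -/

namespace Summit.BirchSwinnertonDyer.BirchSwinnertonDyer.Theorems.SylvesterTwoUpper.LevelOne

variable {V : Type*} [AddCommGroup V] {τ : V →+ V} {Sel : AddSubgroup V} {Kol : ℕ → Prop}
  {A : ℕ → AddSubgroup V} {x : V}

/-- **GLOBAL RIGIDITY (Gross's Claim 10.1 at `p = 2`).**  Let `τ` be an additive involution of `V`
(that `x` is `τ`-fixed is not even needed), and suppose: (`hloc`) for every Kolyvagin prime `ℓ` with `x ∉ A ℓ` and every `s ∈ Sel`,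
`s − τ s ∈ A ℓ`; (`hceb₀`) some Kolyvagin prime has `x ∉ A ℓ`; (`hceb`) for every `d` with
`τ d = −d`, `d ≠ 0`, `d ≠ x` there is a Kolyvagin prime with `x ∉ A ℓ` and `d ∉ A ℓ`.  Then every
Selmer class is `τ`-fixed.  Proof: `d := s − τ s` is anti-fixed (`τ² = 1`) and lies in `A ℓ` at
every type-I prime by `hloc`; if `d = x` this contradicts `hceb₀`, if `d ∉ {0, x}` it contradicts
`hceb`; so `d = 0`.  MEANING: over the Heegner field at `p = 2`, with `y_K ∉ 2E(K)`, every class of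
`Sel₂(E/K)` is fixed by complex conjugation, i.e. `Sel₂(E/K) ⊂ res H¹(ℚ, E[2])` (inflation–
restriction, `E(K)[2] = 0`) — the `p = 2` form of "`Sel(E/K)_p^{−ε} = 0`"; and by ISOTROPY /
EXACTNESS (`…EisensteinTorsion.pairing_halfGen_eq_zero_iff_mem_eigenClosure`) this exhausts what
Heegner-class reciprocity says about `2`-torsion Selmer classes.
[cite: GrossLMS1991, §10 Claim 10.1, Prop. 9.5] [cite: McCallumLMS1991, §3 Cor. 3.2] -/
theorem tau_eq_self_of_locTrivial_of_cebotarev (hτ : ∀ v, τ (τ v) = v)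
    (hloc : ∀ ℓ, Kol ℓ → x ∉ A ℓ → ∀ s ∈ Sel, s - τ s ∈ A ℓ)
    (hceb₀ : ∃ ℓ, Kol ℓ ∧ x ∉ A ℓ)
    (hceb : ∀ d : V, τ d = -d → d ≠ 0 → d ≠ x → ∃ ℓ, Kol ℓ ∧ x ∉ A ℓ ∧ d ∉ A ℓ)
    {s : V} (hs : s ∈ Sel) : τ s = s := by
  set d : V := s - τ s with hd
  have hτd : τ d = -d := by rw [hd, map_sub, hτ, neg_sub]
  by_contra hne
  have hd0 : d ≠ 0 := fun h ↦ hne (sub_eq_zero.mp h).symm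
  by_cases hdx : d = x
  · obtain ⟨ℓ, hℓ, hxA⟩ := hceb₀
    exact hxA (hdx ▸ hloc ℓ hℓ hxA s hs)
  · obtain ⟨ℓ, hℓ, hxA, hdA⟩ := hceb d hτd hd0 hdx
    exact hdA (hloc ℓ hℓ hxA s hs)

/-- **Corollary: the Selmer group has no anti-fixed part beyond `2`-torsion of the fixed part** —
under the same hypotheses, `τ s = −s` for `s ∈ Sel` forces `2s = 0`... stated usefully: every
`s ∈ Sel` satisfies `s - τ s = 0`, so the "minus quotient" `Sel/(1+τ)Sel`-type defects of the
`2`-adic count (`InvolutionDefect.two_smul_eq_fixed_add_antifixed`) do not arise at level `1`.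
[cite: GrossLMS1991, §10 Claim 10.1] -/
theorem sub_tau_eq_zero_of_locTrivial_of_cebotarev (hτ : ∀ v, τ (τ v) = v)
    (hloc : ∀ ℓ, Kol ℓ → x ∉ A ℓ → ∀ s ∈ Sel, s - τ s ∈ A ℓ)
    (hceb₀ : ∃ ℓ, Kol ℓ ∧ x ∉ A ℓ)
    (hceb : ∀ d : V, τ d = -d → d ≠ 0 → d ≠ x → ∃ ℓ, Kol ℓ ∧ x ∉ A ℓ ∧ d ∉ A ℓ)
    {s : V} (hs : s ∈ Sel) : s - τ s = 0 :=
  sub_eq_zero.mpr (tau_eq_self_of_locTrivial_of_cebotarev hτ hloc hceb₀ hceb hs).symm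

end Summit.BirchSwinnertonDyer.BirchSwinnertonDyer.Theorems.SylvesterTwoUpper.LevelOne
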